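import Literature.Topology.FourManifolds.KirbyMovesSlideTransport
import Literature.Topology.FourManifolds.KirbyMovesSlideAlign
import Literature.Topology.FourManifolds.SlidePlaneRotation
import Literature.Topology.FourManifolds.SlideTipMargins
import HarnessLib

/-!
# The dictionary between the page of the slide tube and the meridian plane of the surgered tube

Topic `Literature/Topology/FourManifolds`; fact seat `provefact-IsStrictHandleSlide.isSurgery`
(R. C. Kirby, *The Topology of 4-Manifolds*, LNM 1374 (1989), Ch. I §4, Fig. 4.2; remaining content:
the named fact (S) `Literature.Topology.FourManifolds.FramedLink.IsStrictHandleSlide.slideModel`).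
For a presentation `(φ, ψ)` of `Yⱼ` aligned with the slide tube `ν` at scale `s` (gluing along
`μ = ν.scale s`) and the surgered-tube chart `Ψ` of `exists_surgeredTube`
(`Ψ (w/‖w‖, ‖w‖ • x) = φ (μ (x, w))`), the **page** of the slide — the points
`ν (circlePt a, ρ′ • framingBaseVector)`, `ρ′ > 0`, among which the push-off `Kⱼ'` (`ρ′ = 1`)
and the flat end of the band (`ρ′ = 1 + (1 - x) e₀`) — is the meridian slice of `Ψ` in the
direction `v₀ = circlePoint 0`, and the page point sits at the planar point of polar radius
`ρ′ / (2 s)` and polar angle `2π a` (`page_eq_Ψ`): the push-off is the round circle of radius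
`R₀ = 1 / (2 s)`, and the flat end point `band (x, h)` has polar coordinates
`(R₀ (1 + (1 - x) e₀), ΘB h)`.

## References

* R. C. Kirby, *The Topology of 4-Manifolds*, LNM 1374, Springer (1989), Ch. I §4. [Kirby1989]
* D. Rolfsen, *Knots and Links*, Publish or Perish (1976), §9.F. [Rolfsen1976]
-/

open scoped Manifold ContDiff Topology
open Function Set Metric Real

noncomputable section

namespace Literature.Topology.FourManifolds

/-- Local notation: `𝔼 n` is the model Euclidean space. -/
local notation "𝔼 " n:arg => EuclideanSpace ℝ (Fin n)
/-- Local notation: `𝕊 n` is the unit sphere in `𝔼 (n+1)`. -/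
local notation "𝕊 " n:arg => (Metric.sphere (0 : EuclideanSpace ℝ (Fin (n + 1))) 1)

namespace SlideSweep

/-- **The page direction** `v₀ = circlePoint 0 = (1, 0)`. [folklore] -/
def v₀ : 𝕊 1 := circlePoint 0

/-- `framingBaseVector_eq` (auxiliary). [folklore] -/
theorem framingBaseVector_eq : framingBaseVector = (1 / 2 : ℝ) • ((v₀ : 𝕊 1) : 𝔼 2) := rfl

/-- The planar point `R • circlePt a` in `pl` coordinates. [folklore] -/
theorem smul_circlePt_eq_pl (R a : ℝ) : R • ((circlePt a : 𝕊 1) : 𝔼 2) = pl (R * Real.cos (2 * π * a)) (R * Real.sin (2 * π * a)) := by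
  ext i; fin_cases i <;> simp [pl]

/-- `norm_smul_circlePt` (auxiliary). [folklore] -/
theorem norm_smul_circlePt {R : ℝ} (hR : 0 ≤ R) (a : ℝ) : ‖R • ((circlePt a : 𝕊 1) : 𝔼 2)‖ = R :=
  norm_smul_coe_sphere hR _

variable {K : Knot} (ν : Knot.TubularNbhd K) {s : ℝ}

/-- A page vector `ρ′ • framingBaseVector`, `ρ′ > 0`, is the rescaled vector `s • w` with
`w = (ρ′/s) • framingBaseVector ≠ 0` of direction `v₀` and norm `ρ′ / (2 s)`. [folklore] -/
theorem page_vector (hs : 0 < s) {ρ' : ℝ} (hρ : 0 < ρ') :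
    (ρ' / s) • framingBaseVector ≠ 0 ∧
    radialProjection (spherePt 1) ((ρ' / s) • framingBaseVector) = v₀ ∧
    ‖(ρ' / s) • framingBaseVector‖ = ρ' / (2 * s) ∧
    s • ((ρ' / s) • framingBaseVector) = ρ' • framingBaseVector := by
  have hq : 0 < ρ' / s := div_pos hρ hs
  refine ⟨smul_ne_zero hq.ne' framingBaseVector_ne_zero, ?_, ?_, ?_⟩
  · rw [framingBaseVector_eq, smul_smul]
    exact radialProjection_smul _ (by positivity) _
  · rw [norm_smul, norm_framingBaseVector, Real.norm_of_nonneg hq.le]; field_simp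
  · rw [smul_smul, mul_div_cancel₀ _ hs.ne']

/-- **The page in the surgered tube.** For the chart `Ψ` of `exists_surgeredTube` over
`μ = ν.scale s` (second clause `hΨ`): the page point `ν (circlePt a, ρ′ • framingBaseVector)`
(`ρ′ > 0`) is `Ψ (v₀, (ρ′ / (2 s)) • circlePt a)`. [cite: Kirby1989, Ch. I §4] -/
theorem page_eq_Ψ (hs : 0 < s) {Y : Type*} [TopologicalSpace Y] [ChartedSpace (𝔼 3) Y] {φ : K.complement → Y}
    {core : 𝕊 1 → Y} (Ψ : TubeNbhd (𝓡 3) core)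
    (hΨ : ∀ (x : 𝕊 1) (w : 𝔼 2) (hw : w ≠ 0),
      Ψ.toFun (radialProjection (spherePt 1) w, ‖w‖ • (x : 𝔼 2)) =
        φ ⟨ν.scale s hs (x, w), (ν.scale s hs).apply_mem_compl_range hw⟩)
    {ρ' : ℝ} (hρ : 0 < ρ') (a : ℝ) (hmem : ν (circlePt a, ρ' • framingBaseVector) ∈ K.complement) :
    φ ⟨ν (circlePt a, ρ' • framingBaseVector), hmem⟩ = Ψ.toFun (v₀, (ρ' / (2 * s)) • ((circlePt a : 𝕊 1) : 𝔼 2)) := by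
  obtain ⟨hw, hdir, hnorm, hsc⟩ := page_vector hs hρ
  have h := hΨ (circlePt a) _ hw
  rw [hdir, hnorm] at h
  rw [h]
  congr 1
  apply Subtype.ext
  show ν (circlePt a, ρ' • framingBaseVector) = ν.scale s hs (circlePt a, (ρ' / s) • framingBaseVector)
  rw [Knot.TubularNbhd.scale_apply, hsc]

/-- Page points are off the knot. [folklore] -/
theorem page_mem_complement {ρ' : ℝ} (hρ : 0 < ρ') (a : ℝ) : ν (circlePt a, ρ' • framingBaseVector) ∈ K.complement := by
  rw [SphereEmbedding.mem_complement_iff]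
  exact ν.apply_mem_compl_range (smul_ne_zero hρ.ne' framingBaseVector_ne_zero)

/-- **The flat end in the surgered tube**: a band with flat end of constant rate `e₀` along the
push-off `ν.pushOff` sends `(x, h)` (in the strip) to the planar point of polar radius
`R₀ (1 + (1 - x) e₀)`, `R₀ = 1/(2s)`, and polar angle `ΘB h = 2π thetaB h` in the slice `v₀`.
[cite: Kirby1989, Ch. I §4] -/
theorem flatEnd_eq_Ψ [Knot.TubularNbhd.SmoothnessFacts] (hs : 0 < s) {Y : Type*} [TopologicalSpace Y] [ChartedSpace (𝔼 3) Y]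
    {φ : K.complement → Y} {core : 𝕊 1 → Y} (Ψ : TubeNbhd (𝓡 3) core)
    (hΨ : ∀ (x : 𝕊 1) (w : 𝔼 2) (hw : w ≠ 0),
      Ψ.toFun (radialProjection (spherePt 1) w, ‖w‖ • (x : 𝔼 2)) =
        φ ⟨ν.scale s hs (x, w), (ν.scale s hs).apply_mem_compl_range hw⟩)
    {A' : Knot} {avoid : Set (𝕊 3)} (b : BandCore A' ν.pushOff avoid) {κ e₀ : ℝ} (he₀ : 0 < e₀)
    (hflat : ∀ x ∈ Icc (1 - κ) 1, ∀ h ∈ Icc (10⁻¹ : ℝ) (9 / 10),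
      b.band (pt2 x h) = ν (circlePt (b.thetaB h), (1 + (1 - x) * e₀) • framingBaseVector))
    {x h : ℝ} (hx : x ∈ Icc (1 - κ) 1) (hh : h ∈ Icc (10⁻¹ : ℝ) (9 / 10))
    (hmem : b.band (pt2 x h) ∈ K.complement) :
    φ ⟨b.band (pt2 x h), hmem⟩ =
      Ψ.toFun (v₀, pl ((1 + (1 - x) * e₀) / (2 * s) * Real.cos (b.ΘB h)) ((1 + (1 - x) * e₀) / (2 * s) * Real.sin (b.ΘB h))) := by
  have hr : 0 < 1 + (1 - x) * e₀ := by nlinarith [hx.2, he₀]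
  have hmem' : ν (circlePt (b.thetaB h), (1 + (1 - x) * e₀) • framingBaseVector) ∈ K.complement := page_mem_complement ν hr _
  have h1 : (⟨b.band (pt2 x h), hmem⟩ : K.complement) = ⟨_, hmem'⟩ := Subtype.ext (hflat x hx h hh)
  rw [h1, page_eq_Ψ ν hs Ψ hΨ hr, smul_circlePt_eq_pl]
  rfl

end SlideSweep

end Literature.Topology.FourManifolds
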